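import Summits.HodgeConjecture.HodgeConjecture.Theorems.F0P3SchurLineAtPin
import Summits.HodgeConjecture.HodgeConjecture.Theorems.H413SpectrumJunctionPin
import Summits.HodgeConjecture.HodgeConjecture.Theorems.H413SpectrumOrthogonality
import Summits.HodgeConjecture.HodgeConjecture.Theorems.F0P3HilbertProjection
import Summits.HodgeConjecture.HodgeConjecture.Theorems.F0P3SpectralJunction
import Literature.NumberTheory.Rogawski1990.CohomologicalSpectrumInnerForm
import Literature.NumberTheory.Automorphic.AdelicUnitaryGroupSpectrum
import Mathlib.Analysis.InnerProductSpace.Projection.Submodule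
import HarnessLib

/-!
# FLOOR-0 P3 «U3-mult», line `F0_U3CohMultOne` — the FOLD of the registered stub S3 (holomorphic line) from the engine letters E1, E1′,
# the analytic junction letter (D) and the isotypic-line letter (E); two junction lemmas (the S4 twin is `Theorems/F0P3StubS4Fold.lean`)

Cell hodgecm-mathlib, FLOOR 0; crux item H413 = stmt-HodgeConjecture-24833; line `Cruxes/H413/Lines/F0_U3CohMultOne.lean` v1.1
(cf02d7697f46cc99, F0P3-plan (g0)), registered stubs `stub_S3_holLineAt : StubS3HolLineAt`, `stub_S4_antiholLineAt : StubS4AntiholLineAt`;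
seat F0P3-p03 (lead ruling 2026-08-30T22:05:21Z (2)–(3): «S3 ∕ S4 ⇐ TP + E1′ + E1″ + junction + p03's lift … p03 = S3∕S4 folds over
(1∕3)(2∕3) + (D) + (E) + E1′»).  THEOREMS ONLY (no definition, no named fact, no `sorry`, no new stub, no edit of the Lines file);
nothing of [Liu2021] ∕ [Rogawski1990] is asserted; HC_CM is proved only modulo the printed citations until rung 0 closes.

WHAT S3 SAYS.  For every face `(hDel, F, V, a₀, Φ, i)` with `3 ≤ n` and every admissible weight-one triple `t` of `P = datum413 …`, the
`U(V)(𝔸_{F⁺,f})`-equivariant `ℂ`-linear maps `ψ : ω_V(t) → (U(V)(𝔸_{F⁺}) → ℂ²)` with values in `holCotForms 𝔞₀`, `𝔞₀ = archFactorOf F V`,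
lie on ONE LINE; S4: the same with values in `(holCotForms 𝔞₀).map conjFun`.

THE FOLD `stubS3_of_letters` (conclusion = the registered type of S3, binder for binder; `stub_S3_holLineAt := stubS3_of_letters hE1 hE1' hD hE hcont`).
Inputs: E1 ★ `Rogawski1990.innerFormMultiplicityLeOne` (multiplicity `≤ 1` of the discrete spectrum of the inner form ⇒ distinct discrete
`Π` are ORTHOGONAL, ★ `SpectrumJunction.isOrtho_space_of_ne_of_innerFormMultiplicityLeOne`), E1′ ★ `Rogawski1990.cohFinComponentUnique_hol`
(at most one `(1,0)`-type discrete `Π` with finite component `σ`), BY NAME; the analytic letter (D) «a discrete `Π` NOT ORTHOGONAL to the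
class of a coordinate of a holomorphic cotangent form is `(1,0)`-cohomological» and the isotypic-line letter (E) = E1″ «for `σ` irreducible
smooth admissible and `Π` discrete, the equivariant maps `σ → X` valued in holomorphic cotangent forms CONTAINED IN `Π` lie on one line»,
both carried as HYPOTHESES BY TEXT (the detection form fixed by the lead 22:08:35Z = F0P3-p02's `hTPhol`; (E) = F0P3-p03's NAME PROPOSAL
22:15Z) until F0-typ1's `Literature/NumberTheory/Automorphic/UnitaryGroupCotangentSpectralProjection.lean` lands, after which the by-name
closer is a one-line application; and `hcont` (the cohomological cotangent forms of the factor of record are continuous on `U(V)(𝔸_{F⁺})`,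
A-p09's `H413CohFormsContinuous`).  PROOF.  Fix the face and `t`; if every equivariant `holCotForms 𝔞₀`-valued `ψ` vanishes, `ψ₀ := 0`.
Else pick `ψ₁ ≠ 0`: `ω_V(t) ≠ 0` is irreducible, smooth and admissible ([Liu2021, Def. 4.11] = ★ `Theorems.H411_proof`, via ★
`F0P3SchurLineAtPin`); take an automorphic measure `μ` (★ `exists_isAutomorphicMeasure_isDiscretelyDecomposable_adelicGroupData`; the
quotient is compact, `4 ≤ [F:ℚ]`); the class `v₁` of a non-vanishing coordinate of `ψ₁ w₁` is `≠ 0` (★ `toLp_toQuotFun_ne_zero`), so some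
irreducible closed `Π₀ ≤ L²(μ)` is not orthogonal to it (★ `F0P3HilbertProjection.exists_irreducible_not_orthogonal`); by (D) `Π₀` is
`(1,0)`-cohomological and by ★ `F0P3SpectralJunction.hasFinComponent_of_not_orthogonal` (F0P3-p02: `w ↦ pr_{Π₀}[ψ₁ w]` is a non-zero
intertwiner, injective by irreducibility) `Π₀.HasFinComponent ω_V(t)`.  CLAIM: every equivariant `holCotForms 𝔞₀`-valued `ψ` has ALL its coordinate classes in `Π₀`
(`mem_space_of_forall_detected_eq`, §1): else the component of some class `v` orthogonal to `Π₀` is `≠ 0`, meets some irreducible closed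
`Π ≠ Π₀`, `Π ⊥ Π₀` (E1), so `Π` is not orthogonal to `v` itself, hence (D) `(1,0)`-cohomological with finite component `ω_V(t)` (same lemma), and E1′
forces `Π = Π₀` — contradiction.  So `Π₀.ContainsForm (ψ w)` for all such `ψ`, `w`, and (E) at `Π₀` gives the line.  S4: the same with the
antiholomorphic letters.

## References
* [Liu2021] Y. Liu, Camb. J. Math. 9 (2021) — proof of Prop. 4.13, ll. 2131–2146; Def. 4.11.
* [Rogawski1990] J. Rogawski, Ann. of Math. Stud. 123 (1990) — §14.6 (Prop. 14.6.2, Thm. 14.6.4, Thm. 14.6.5), §15.3 ¶1, §12.3 p. 174,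
  Prop. 15.2.1 (b).
* [BorelJacquet1979] A. Borel, H. Jacquet, Corvallis PSPM 33.1 — §4.6.  [Dixmier1977] J. Dixmier, *C*-algebras* — §5.4, §13.1.
* [BorelWallach2000] A. Borel, N. Wallach, 2nd ed. — VII 3.2, 3.6; XIII 1.2.  [Bump1997] D. Bump — Prop. 4.2.4.
* Tree: ★ `Theorems/F0P3SchurLineAtPin.lean` (Def. 4.11 adjectives at the pin), ★ `Theorems/H413SpectrumJunction{,Pin}.lean` (F0P3-p04:
  `toQuotFun` calculus, `memLp_toQuotFun`, `toLp_toQuotFun_ne_zero`, transport `toLp_toQuotFun_mul_right`, `containsForm_iff_of_memLp`,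
  compactness at the pin), ★ `Theorems/H413SpectrumOrthogonality.lean` (F0P3-p04: E1 ⇒ orthogonality), ★ `Theorems/F0P3HilbertProjection.lean`
  ∕ `F0P3SpectralJunction.lean` (F0P3-p02: `exists_irreducible_not_orthogonal`, `orthogonalProjectionOnto_ne_zero`, `hasFinComponent_of_not_orthogonal`), ★ `Literature/…/AdelicUnitaryGroupSpectrum`.
-/

set_option autoImplicit false

-- the mandated namespace has the single-problem summit's repeated segment (`HodgeConjecture.HodgeConjecture`)
set_option linter.dupNamespace false

noncomputable section

namespace Summit.HodgeConjecture.HodgeConjecture.Cruxes.H413.F0P3StubS3Fold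

open scoped InnerProductSpace ENNReal Matrix ComplexOrder
open MeasureTheory NumberField
open Literature.NumberTheory.Automorphic Literature.NumberTheory.Automorphic.UnitaryGroup
open Literature.NumberTheory.Automorphic.UnitaryGroup.CotangentForms (toQuotFun cmArchSection cmCompactFactor)
open Summit.HodgeConjecture.HodgeConjecture.Cruxes.H413.SpectrumJunction
open Summit.HodgeConjecture.HodgeConjecture.Cruxes.H413.F0P3HilbertProjection

/-! ## §1 The Hilbert-space lemma «all projections but THE `Π₀` vanish ⇒ the class lies in `Π₀`» (the junction lemma «a discrete `Π` not
orthogonal to a coordinate class of `ψ w₀` has finite component `σ`» is F0P3-p02's ★ `F0P3SpectralJunction.hasFinComponent_of_not_orthogonal`) -/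



section Hilbert

variable {K : Type} [Field K] [NumberField K] {𝒢 : AdelicGroupData.{0} K}
  {μ : Measure 𝒢.automorphicQuotient} [SMulInvariantMeasure 𝒢.Adelic 𝒢.automorphicQuotient μ]

/-- **«All projections but THE `Π₀` vanish ⇒ the class lies in `Π₀`.»**  In a discretely decomposable `L²(G(K)\G(𝔸_K), μ)` whose
regular representation has multiplicity one (so distinct discrete `Π` are orthogonal, ★ `isOrtho_space_of_ne`): if EVERY discrete `Π`
not orthogonal to `v` equals `Π₀`, then `v ∈ Π₀`.  (The component `v - pr_{Π₀} v ∈ Π₀ᗮ`, if non-zero, meets some irreducible closed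
`Π` (★ `exists_irreducible_not_orthogonal`); `Π ≠ Π₀`, so `Π ⊥ Π₀` and `Π` is not orthogonal to `v` itself — contradiction.)
[cite: Dixmier1977, §5.4 and §13.1] [cite: BorelJacquet1979, §4.6] -/
theorem mem_space_of_forall_detected_eq (hdisc : (𝒢.rightRegular μ).IsDiscretelyDecomposable)
    (h1 : (𝒢.rightRegular μ).HasMultiplicityOne) (P₀ : DiscreteAutomorphicRep 𝒢 μ) (v : 𝒢.L2 μ)
    (huniq : ∀ P : DiscreteAutomorphicRep 𝒢 μ, (∃ u ∈ P.space, ⟪(u : 𝒢.L2 μ), v⟫_ℂ ≠ 0) → P = P₀) :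
    v ∈ P₀.space.toSubmodule := by
  set p : 𝒢.L2 μ := (P₀.space.toSubmodule.orthogonalProjectionOnto v : 𝒢.L2 μ) with hp
  have hpmem : p ∈ P₀.space.toSubmodule := (P₀.space.toSubmodule.orthogonalProjectionOnto v).2
  have hu_orth : v - p ∈ (P₀.space.toSubmodule)ᗮ := by
    rw [hp, ← Submodule.starProjection_apply]
    exact Submodule.sub_starProjection_mem_orthogonal v
  by_cases hu : v - p = 0
  · rw [sub_eq_zero] at hu
    rw [hu]
    exact hpmem
  · exfalso
    obtain ⟨Wc, hWirr, x, hx, hxu⟩ := exists_irreducible_not_orthogonal hdisc hu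
    let P : DiscreteAutomorphicRep 𝒢 μ := ⟨Wc, hWirr⟩
    -- `P ≠ P₀`: `x ∈ P₀` would be orthogonal to `v - p ∈ P₀ᗮ`
    have hne : P ≠ P₀ := by
      intro hPP
      have hx0 : x ∈ P₀.space.toSubmodule := by
        have : P.space = P₀.space := by rw [hPP]
        exact this ▸ hx
      exact hxu (Submodule.inner_right_of_mem_orthogonal hx0 hu_orth)
    -- `P ⊥ P₀`, so `⟪x, p⟫ = 0` and `⟪x, v⟫ = ⟪x, v - p⟫ ≠ 0`
    have horth : P.space.toSubmodule ⟂ P₀.space.toSubmodule := isOrtho_space_of_ne h1 hne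
    have hxp : ⟪(x : 𝒢.L2 μ), p⟫_ℂ = 0 := horth.inner_eq hx hpmem
    have hxv : ⟪(x : 𝒢.L2 μ), v⟫_ℂ ≠ 0 := by
      have : ⟪(x : 𝒢.L2 μ), v⟫_ℂ = ⟪(x : 𝒢.L2 μ), v - p⟫_ℂ := by rw [inner_sub_right, hxp, sub_zero]
      rw [this]
      exact hxu
    exact hne (huniq P ⟨x, hx, hxv⟩)

end Hilbert


/-! ## §2 The fold of the registered S3 from the letters (type VERBATIM from the Lines file v1.1 ll. 201–210; S4: sibling file) -/

section Pin

open HodgeCM.Model HodgeCM.Model.LiuIndex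
open Literature.AlgebraicGeometry.Motives (CMType)
open Literature.NumberTheory.Automorphic.Liu2021
open Summit.HodgeConjecture.CorCM.Lines.A3Liu413 (datum413)
open Summit.HodgeConjecture.HodgeConjecture.Cruxes.H413.CohFormsCarriers
open Summit.HodgeConjecture.HodgeConjecture.Cruxes.H413.F0P3SchurLineAtPin

set_option synthInstance.maxHeartbeats 400000 in
set_option maxHeartbeats 8000000 in
/-- **THE S3 FOLD FROM THE LETTERS — `StubS3HolLineAt` (the registered type, binder for binder) from E1 ★ `innerFormMultiplicityLeOne`,
E1′ ★ `cohFinComponentUnique_hol` (by name), the analytic junction letter (D) `hDhol` («a discrete `Π` not orthogonal to a coordinate class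
of a holomorphic cotangent form is `(1,0)`-cohomological», F0P3-p02's detection text) and the isotypic-line letter (E) `hEhol` (E1″, «for
`σ` irreducible smooth admissible and `Π` discrete, the equivariant maps valued in holomorphic cotangent forms contained in `Π` lie on one
line», F0P3-p03's NAME PROPOSAL), both BY TEXT until F0-typ1's `UnitaryGroupCotangentSpectralProjection` lands; `hcont` = continuity of the
cohomological cotangent forms (A-p09).**  Proof in the module docstring; Schur's input «`ω_V(t)` irreducible admissible» is ★
`F0P3SchurLineAtPin` ([Liu2021, Def. 4.11]).  By-name closer: `stub_S3_holLineAt := stubS3_of_letters hE1 hE1' hDhol hEhol hcont`.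
HC_CM is proved only modulo the printed citations until rung 0 closes. [cite: Rogawski1990, §14.6 Thm. 14.6.4; §15.3 ¶1; §12.3 p. 174;
Prop. 15.2.1 (b)] [cite: BorelJacquet1979, §4.6] [cite: Dixmier1977, §5.4] [cite: BorelWallach2000, VII 3.2 and 3.6] [cite: Liu2021, proof of
Prop. 4.13, l. 2131–2146] -/
theorem stubS3_of_letters (hE1 : Literature.NumberTheory.Rogawski1990.innerFormMultiplicityLeOne)
    (hE1' : Literature.NumberTheory.Rogawski1990.cohFinComponentUnique_hol)
    (hDhol : ∀ (L : Type) [Field L] [NumberField L] [IsCMField L] (ι : L →+* ℂ) (H : Matrix (Fin 3) (Fin 3) L) (T : GL (Fin 3) ℂ)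
      (hT : (T : Matrix (Fin 3) (Fin 3) ℂ)ᴴ * H.map ι * (T : Matrix (Fin 3) (Fin 3) ℂ) = Literature.Geometry.ComplexHyperbolic.BallModel.J),
      (∀ τ' : L →+* ℂ, InfinitePlace.mk τ' ≠ InfinitePlace.mk ι → (H.map τ').PosDef) →
      2 ≤ Module.finrank ℚ ↥(maximalRealSubfield L) →
      ∀ (μ : Measure (adelicGroupData (↥(maximalRealSubfield L)) L (IsCMField.complexConj L) 3 H).automorphicQuotient)
        [(adelicGroupData (↥(maximalRealSubfield L)) L (IsCMField.complexConj L) 3 H).IsAutomorphicMeasure μ]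
        (P : DiscreteAutomorphicRep (adelicGroupData (↥(maximalRealSubfield L)) L (IsCMField.complexConj L) 3 H) μ)
        (Φ : (adelicGroupData (↥(maximalRealSubfield L)) L (IsCMField.complexConj L) 3 H).Adelic → (Fin 2 → ℂ)),
        Φ ∈ CotangentForms.holCotForms (↥(maximalRealSubfield L)) L (IsCMField.complexConj L) 3 H (cmArchSection L ι H T hT)
          (cmCompactFactor L ι H T hT) →
        ∀ (h : ∀ j : Fin 2, MemLp (toQuotFun (adelicGroupData (↥(maximalRealSubfield L)) L (IsCMField.complexConj L) 3 H)
          fun x => Φ x j) 2 μ),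
        (∃ (j : Fin 2), ∃ u ∈ P.space,
          ⟪(u : (adelicGroupData (↥(maximalRealSubfield L)) L (IsCMField.complexConj L) 3 H).L2 μ), (h j).toLp⟫_ℂ ≠ 0) →
        P.IsHolCotangentAt (cmArchSection L ι H T hT) (cmCompactFactor L ι H T hT))
    (hEhol : ∀ (L : Type) [Field L] [NumberField L] [IsCMField L] (ι : L →+* ℂ) (H : Matrix (Fin 3) (Fin 3) L) (T : GL (Fin 3) ℂ)
      (hT : (T : Matrix (Fin 3) (Fin 3) ℂ)ᴴ * H.map ι * (T : Matrix (Fin 3) (Fin 3) ℂ) = Literature.Geometry.ComplexHyperbolic.BallModel.J),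
      (∀ τ' : L →+* ℂ, InfinitePlace.mk τ' ≠ InfinitePlace.mk ι → (H.map τ').PosDef) →
      2 ≤ Module.finrank ℚ ↥(maximalRealSubfield L) →
      ∀ (μ : Measure (adelicGroupData (↥(maximalRealSubfield L)) L (IsCMField.complexConj L) 3 H).automorphicQuotient)
      [(adelicGroupData (↥(maximalRealSubfield L)) L (IsCMField.complexConj L) 3 H).IsAutomorphicMeasure μ]
      (W : Type) [AddCommGroup W] [Module ℂ W]
      (σ : Representation ℂ (finAdelic (↥(maximalRealSubfield L)) L (IsCMField.complexConj L) 3 H) W),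
      σ.IsIrreducible → σ.IsSmooth → σ.IsAdmissible →
      ∀ P : DiscreteAutomorphicRep (adelicGroupData (↥(maximalRealSubfield L)) L (IsCMField.complexConj L) 3 H) μ,
      ∃ ψ₀ : W →ₗ[ℂ] ((adelicGroupData (↥(maximalRealSubfield L)) L (IsCMField.complexConj L) 3 H).Adelic → (Fin 2 → ℂ)),
      ∀ ψ : W →ₗ[ℂ] ((adelicGroupData (↥(maximalRealSubfield L)) L (IsCMField.complexConj L) 3 H).Adelic → (Fin 2 → ℂ)),
      (∀ (g : finAdelic (↥(maximalRealSubfield L)) L (IsCMField.complexConj L) 3 H) (w : W),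
      ψ (σ g w) = CotangentForms.rightRep (↥(maximalRealSubfield L)) L (IsCMField.complexConj L) 3 H g (ψ w)) →
      (∀ w : W, ψ w ∈ CotangentForms.holCotForms (↥(maximalRealSubfield L)) L (IsCMField.complexConj L) 3 H (cmArchSection L ι H T hT)
      (cmCompactFactor L ι H T hT) ∧ P.ContainsForm (ψ w)) →
      ∃ r : ℂ, ψ = r • ψ₀)
    (hcont : ∀ (F : HodgeCM.CMField) {ι₁ : F →+* ℂ} (V : HodgeCM.HermSpace3 F ι₁), 4 ≤ Module.finrank ℚ F →
      ∀ f ∈ cohForms (archFactorOf F V), ∀ j : Fin 2, Continuous fun x => f x j) :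
    ∀ (hDel : Literature.AlgebraicGeometry.ShimuraVarieties.UnitaryCanonicalModel.canonicalModel_exists_printed)
      (F : HodgeCM.CMField) [IsGalois ℚ F] (h6 : 6 ≤ Module.finrank ℚ F) {ι₁ : F →+* ℂ} (V : HodgeCM.HermSpace3 F ι₁) (a₀ : RealScalar F)
      (Φ : CMType F) (hΦ : ι₁ ∈ Φ.1) (i : (I V (repAt a₀) (muLiu ι₁ GramClass.rep))),
      3 ≤ (datum413 hDel F V a₀ Φ i).n → ∀ t : (datum413 hDel F V a₀ Φ i).AdmTriple,
        ∃ ψ₀ : (datum413 hDel F V a₀ Φ i).omegaAt t →ₗ[ℂ] ((adelicDatum F V).Adelic → (Fin 2 → ℂ)),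
          ∀ ψ : (datum413 hDel F V a₀ Φ i).omegaAt t →ₗ[ℂ] ((adelicDatum F V).Adelic → (Fin 2 → ℂ)),
            (∀ (g : ↥(HodgeCM.HermSpace3.adelicFin V)) (w : (datum413 hDel F V a₀ Φ i).omegaAt t),
                ψ ((datum413 hDel F V a₀ Φ i).rhoAt t g w) = rightRep F V g (ψ w)) →
              (∀ w, ψ w ∈ holCotForms (archFactorOf F V)) → ∃ r : ℂ, ψ = r • ψ₀ := by
  intro hDel F _ h6 ι₁ V a₀ Φ hΦ i hn t
  -- the degenerate case: no non-zero equivariant `A`-valued map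
  by_cases hex : ∃ ψ₁ : (datum413 hDel F V a₀ Φ i).omegaAt t →ₗ[ℂ] ((adelicDatum F V).Adelic → (Fin 2 → ℂ)),
      (∀ (g : ↥(HodgeCM.HermSpace3.adelicFin V)) (w : (datum413 hDel F V a₀ Φ i).omegaAt t),
          ψ₁ ((datum413 hDel F V a₀ Φ i).rhoAt t g w) = rightRep F V g (ψ₁ w)) ∧
        (∀ w, ψ₁ w ∈ holCotForms (archFactorOf F V)) ∧ ψ₁ ≠ 0
  swap
  · refine ⟨0, fun ψ hψe hψv => ⟨0, ?_⟩⟩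
    have hψ0 : ψ = 0 := by
      by_contra hne
      exact hex ⟨ψ, hψe, hψv, hne⟩
    rw [hψ0, smul_zero]
  obtain ⟨ψ₁, hψ₁e, hψ₁v, hψ₁0⟩ := hex
  have h4 : 4 ≤ Module.finrank ℚ F := le_trans (by norm_num) h6
  have h2 : 2 ≤ Module.finrank ℚ ↥(maximalRealSubfield (HodgeCM.CMField.K F)) := by
    have h := Module.finrank_mul_finrank ℚ ↥(maximalRealSubfield (HodgeCM.CMField.K F)) (HodgeCM.CMField.K F)
    rw [Algebra.IsQuadraticExtension.finrank_eq_two ↥(maximalRealSubfield (HodgeCM.CMField.K F)) (HodgeCM.CMField.K F)] at h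
    change _ = Module.finrank ℚ F at h
    omega
  -- an automorphic measure with discretely decomposable `L²` (the quotient is compact: `Hm V` is anisotropic)
  obtain ⟨τ, hτ⟩ := UnitaryGroup.exists_infinitePlace_ne (HodgeCM.CMField.K F) h4 ι₁
  have han := UnitaryGroup.anisotropic_of_posDef_map (HodgeCM.CMField.K F) (HodgeCM.HermSpace3.Hm V) τ (V.posDef_of_ne τ hτ)
  obtain ⟨μ, hμ, hdisc⟩ := UnitaryGroup.exists_isAutomorphicMeasure_isDiscretelyDecomposable_adelicGroupData (HodgeCM.CMField.K F) 3
    (HodgeCM.HermSpace3.Hm V) han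
  haveI := hμ
  haveI := compactSpace_automorphicQuotient_adelicDatum F V h4
  have h1 := hasMultiplicityOne_rightRegular_of_innerFormMultiplicityLeOne hE1 (HodgeCM.CMField.K F) ι₁ (HodgeCM.HermSpace3.Hm V)
    V.sylvesterFrame (HodgeCM.Model.sylvesterFrame_J V) V.posDef_of_ne h2 μ
  -- `ω_V(t) ≠ 0` is irreducible, smooth, admissible ([Liu2021, Def. 4.11] = ★ `Theorems.H411_proof`)
  obtain ⟨w₁, hw₁⟩ : ∃ w, ψ₁ w ≠ 0 := by
    by_contra h
    push Not at h
    exact hψ₁0 (LinearMap.ext h)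
  have hW : Nontrivial ((datum413 hDel F V a₀ Φ i).omegaAt t) := ⟨⟨w₁, 0, fun h => hw₁ (by rw [h, map_zero])⟩⟩
  have hirr := isIrreducible_rhoAt_datum413 hDel F h6 V a₀ Φ hΦ i t hW
  have hadm := isAdmissible_rhoAt_datum413 hDel F h6 V a₀ Φ hΦ i t
  have hsm : ((datum413 hDel F V a₀ Φ i).rhoAt t).IsSmooth := hadm.isSmooth
  -- bookkeeping for equivariant `A`-valued maps: membership in `cohForms`, left invariance, continuity, `L²` classes
  have hcoh : ∀ {f : (adelicDatum F V).Adelic → (Fin 2 → ℂ)}, f ∈ holCotForms (archFactorOf F V) → f ∈ cohForms (archFactorOf F V) := by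
    intro f hf
    exact Submodule.mem_sup_left hf
  have hleft : ∀ {f : (adelicDatum F V).Adelic → (Fin 2 → ℂ)}, f ∈ holCotForms (archFactorOf F V) →
      ∀ γ ∈ (adelicDatum F V).quotientSubgroup, ∀ x, f (γ * x) = f x := by
    intro f hf
    exact leftInvariant_of_mem_cohForms_pin (hcoh hf)
  have hmem : ∀ {f : (adelicDatum F V).Adelic → (Fin 2 → ℂ)}, f ∈ holCotForms (archFactorOf F V) →
      ∀ j : Fin 2, MemLp (toQuotFun (adelicDatum F V) fun x => f x j) 2 μ := by
    intro f hf j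
    exact memLp_toQuotFun_pin h4 (hcoh hf) j (hcont F V h4 f (hcoh hf) j) 2
  have heqv_generic : ∀ ψ : (datum413 hDel F V a₀ Φ i).omegaAt t →ₗ[ℂ] ((adelicDatum F V).Adelic → (Fin 2 → ℂ)),
      (∀ (g : ↥(HodgeCM.HermSpace3.adelicFin V)) (w : (datum413 hDel F V a₀ Φ i).omegaAt t),
          ψ ((datum413 hDel F V a₀ Φ i).rhoAt t g w) = rightRep F V g (ψ w)) →
        ∀ (g : ↥(HodgeCM.HermSpace3.adelicFin V)) (w : (datum413 hDel F V a₀ Φ i).omegaAt t),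
          ψ ((datum413 hDel F V a₀ Φ i).rhoAt t g w) =
            CotangentForms.rightRep (↥(maximalRealSubfield (HodgeCM.CMField.K F))) (HodgeCM.CMField.K F)
              (IsCMField.complexConj (HodgeCM.CMField.K F)) 3 (HodgeCM.HermSpace3.Hm V) g (ψ w) := by
    intro ψ hψe g w
    rw [← rightRep_eq_generic]
    exact hψe g w
  -- §1: a discrete `Π` not orthogonal to a coordinate class of `ψ w` has finite component `ω_V(t)`
  have hfin : ∀ (ψ : (datum413 hDel F V a₀ Φ i).omegaAt t →ₗ[ℂ] ((adelicDatum F V).Adelic → (Fin 2 → ℂ)))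
      (hψe : ∀ (g : ↥(HodgeCM.HermSpace3.adelicFin V)) (w : (datum413 hDel F V a₀ Φ i).omegaAt t),
        ψ ((datum413 hDel F V a₀ Φ i).rhoAt t g w) = rightRep F V g (ψ w))
      (hψv : ∀ w, ψ w ∈ holCotForms (archFactorOf F V)) (P : DiscreteAutomorphicRep (adelicDatum F V) μ)
      (w : (datum413 hDel F V a₀ Φ i).omegaAt t) (j : Fin 2),
      (∃ u ∈ P.space, ⟪(u : (adelicDatum F V).L2 μ), (hmem (hψv w) j).toLp⟫_ℂ ≠ 0) →
        P.HasFinComponent ((datum413 hDel F V a₀ Φ i).rhoAt t) :=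
    fun ψ hψe hψv P w j hu => F0P3SpectralJunction.hasFinComponent_of_not_orthogonal P ((datum413 hDel F V a₀ Φ i).rhoAt t) hirr ψ
      (heqv_generic ψ hψe) (fun w => hleft (hψv w)) (fun w j => hcont F V h4 (ψ w) (hcoh (hψv w)) j) (hmem (hψv w) j) hu
  -- letter (D): such a `Π` is `IsHolCotangentAt`-cohomological
  have htype : ∀ (ψ : (datum413 hDel F V a₀ Φ i).omegaAt t →ₗ[ℂ] ((adelicDatum F V).Adelic → (Fin 2 → ℂ)))
      (hψv : ∀ w, ψ w ∈ holCotForms (archFactorOf F V)) (P : DiscreteAutomorphicRep (adelicDatum F V) μ)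
      (w : (datum413 hDel F V a₀ Φ i).omegaAt t) (j : Fin 2),
      (∃ u ∈ P.space, ⟪(u : (adelicDatum F V).L2 μ), (hmem (hψv w) j).toLp⟫_ℂ ≠ 0) →
        P.IsHolCotangentAt (archFactorOf F V).ιinf (archFactorOf F V).Kc :=
    fun ψ hψv P w j hu => hDhol (HodgeCM.CMField.K F) ι₁ (HodgeCM.HermSpace3.Hm V) V.sylvesterFrame (HodgeCM.Model.sylvesterFrame_J V)
      V.posDef_of_ne h2 μ P (ψ w) (hψv w) (hmem (hψv w)) ⟨j, hu⟩
  -- THE `Π₀`: an irreducible closed subspace not orthogonal to a non-zero coordinate class of `ψ₁ w₁`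
  obtain ⟨x₁, j₁, hx₁⟩ : ∃ (x : (adelicDatum F V).Adelic) (j : Fin 2), ψ₁ w₁ x j ≠ 0 := by
    by_contra h
    push Not at h
    exact hw₁ (funext fun x => funext fun j => h x j)
  have hΦne : (fun y => ψ₁ w₁ y j₁) ≠ 0 := fun h0 => hx₁ (by simpa using congrFun h0 x₁)
  have hv₁ : (hmem (hψ₁v w₁) j₁).toLp (toQuotFun (adelicDatum F V) fun x => ψ₁ w₁ x j₁) ≠ 0 :=
    toLp_toQuotFun_ne_zero (fun γ hγ x => by simp only [hleft (hψ₁v w₁) γ hγ x])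
      (hcont F V h4 (ψ₁ w₁) (hcoh (hψ₁v w₁)) j₁) (hmem (hψ₁v w₁) j₁) hΦne
  obtain ⟨W₀, hW₀irr, u₁, hu₁, hu₁v⟩ := exists_irreducible_not_orthogonal hdisc hv₁
  let P₀ : DiscreteAutomorphicRep (adelicDatum F V) μ := ⟨W₀, hW₀irr⟩
  have hP₀type : P₀.IsHolCotangentAt (archFactorOf F V).ιinf (archFactorOf F V).Kc := htype ψ₁ hψ₁v P₀ w₁ j₁ ⟨u₁, hu₁, hu₁v⟩
  have hP₀fin : P₀.HasFinComponent ((datum413 hDel F V a₀ Φ i).rhoAt t) := hfin ψ₁ hψ₁e hψ₁v P₀ w₁ j₁ ⟨u₁, hu₁, hu₁v⟩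
  -- letter (E) at `Π₀`
  obtain ⟨ψ₀, hψ₀⟩ := hEhol (HodgeCM.CMField.K F) ι₁ (HodgeCM.HermSpace3.Hm V) V.sylvesterFrame (HodgeCM.Model.sylvesterFrame_J V)
    V.posDef_of_ne h2 μ ((datum413 hDel F V a₀ Φ i).omegaAt t) ((datum413 hDel F V a₀ Φ i).rhoAt t) hirr hsm hadm P₀
  refine ⟨ψ₀, fun ψ hψe hψv => hψ₀ ψ (heqv_generic ψ hψe) fun w => ⟨hψv w, ?_⟩⟩
  -- every coordinate class of `ψ w` lies in `Π₀`: all other discrete `Π` it could meet are `IsHolCotangentAt`-type with finite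
  -- component `ω_V(t)`, hence `= Π₀` by E1′; distinct `Π` are orthogonal by E1
  rw [containsForm_iff_of_memLp P₀ (ψ w) (hmem (hψv w))]
  intro j
  refine mem_space_of_forall_detected_eq hdisc h1 P₀ _ fun P hu => ?_
  exact hE1' (HodgeCM.CMField.K F) ι₁ (HodgeCM.HermSpace3.Hm V) V.sylvesterFrame (HodgeCM.Model.sylvesterFrame_J V) V.posDef_of_ne h2 μ
    ((datum413 hDel F V a₀ Φ i).omegaAt t) ((datum413 hDel F V a₀ Φ i).rhoAt t) hirr hsm P P₀ (htype ψ hψv P w j hu) hP₀type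
    (hfin ψ hψe hψv P w j hu) hP₀fin

end Pin

end Summit.HodgeConjecture.HodgeConjecture.Cruxes.H413.F0P3StubS3Fold

end
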